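import Summits.SmoothPoincare4.SmoothPoincare4.Theorems.CongruenceShadowsAgkCor6SufficiencyGeomMarkingDefs
import Literature.AlgebraicTopology.FundamentalGroup.DeformationRetractInclusion
import Literature.AlgebraicTopology.FundamentalGroup.BallWithArcsBasis
import Literature.AlgebraicTopology.FundamentalGroup.CellAttachmentKernelLoop
import Literature.AlgebraicTopology.Homotopy.StrongDeformationRetractUnion
import HarnessLib

/-!
# Stub `stub_nestedCellsBasis` of line `lp-by-sphere-system-surgery` for crux `AgkCor6Sufficiency`
(item stmt-SmoothPoincare4-10894, routes `CongruenceShadows` / `GroupTrisection`; lead reshape r6b)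

**Nested cells: a cell basis of the outer cell is a cell basis of the inner cell** (`π₁` plumbing
only; the annulus geometry arrives as hypotheses).  Let `Φ`, `Ψ` be chart-like `2`-cells in the
closed set `F` with `Φ(B̄(0,1)) ⊆ Ψ(B(0,1))`, and suppose the region
`R = Ψ(B̄(0,1)) ∖ Φ(B(0,1))` between the two holes strong deformation retracts onto the outer
seam circle `C = Ψ(‖z‖ = 1)`, is path connected, contains the inner circle `Φ(‖z‖ = 1)`, and
every generator of `π₁` of the inner circle generates `π₁(R)`.  Then a cell basis of genus `g`
for `Ψ` (a free basis `θ : F⟨a₁, …, b_g⟩ ≅ π₁(F ∖ Ψ(B(0,1)), Ψ(1,0))` reading `C` as `r_g`) yields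
one for `Φ`:

1. paste the deformation of `R` with the identity of `A = F ∖ Ψ(B(0,1))`
   (`IsStrongDeformationRetractOf.union_of_inter_subset`): `A` is a strong deformation retract of
   `A ∪ R = F ∖ Φ(B(0,1))`, so `π₁(A) → π₁(F ∖ Φ(B(0,1)))` is bijective (Hatcher, Prop. 1.17,
   `bijective_inclHomOfSubset_of_isStrongDeformationRetractOf`);
2. move the base point from `Ψ(1,0)` to `Φ(1,0)` along a path `γ ⊆ R`
   (`FundamentalGroup.fundamentalGroupMulEquivOfPath`, natural for inclusions:
   `inclHomOfSubset_fundamentalGroupMulEquivOfPath`);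
3. in `π₁(R, Φ(1,0)) ≅ π₁(C) ≅ ℤ` the transported outer generator and the image of a generator
   `t₀` of `π₁` of the inner circle are two generators of `ℤ`, hence equal or inverse; the new
   boundary generator is `t₀` or `t₀⁻¹` accordingly.

References: Hatcher, *Algebraic Topology* (2002), Prop. 1.5, Thm. 1.7, Prop. 1.17 [HatcherAT2002].
No `sorry`.
-/

set_option linter.dupNamespace false

noncomputable section

open Set Function ContinuousMap Metric
open scoped Manifold ContDiff Topology

namespace Summit.SmoothPoincare4.SmoothPoincare4.Cruxes.AgkCor6Sufficiency.LpBySphereSystemSurgery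

open Literature.Topology.FourManifolds
open Literature.AlgebraicTopology.FundamentalGroup
open Literature.AlgebraicTopology.FundamentalGroup.VanKampen
open Literature.AlgebraicTopology.Homotopy

/-! ## Helpers -/

/-- Two generators of an infinite cyclic group are equal or mutually inverse. -/
private theorem eq_or_eq_inv_of_closure_singleton_eq_top {G : Type*} [Group G]
    (e : G ≃* Multiplicative ℤ) {c d : G} (hc : Subgroup.closure ({c} : Set G) = ⊤)
    (hd : Subgroup.closure ({d} : Set G) = ⊤) : c = d ∨ c = d⁻¹ := by
  -- a generator of `Multiplicative ℤ` is `ofAdd 1` or its inverse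
  have key : ∀ x : G, Subgroup.closure ({x} : Set G) = ⊤ →
      e x = Multiplicative.ofAdd (1 : ℤ) ∨ e x = (Multiplicative.ofAdd (1 : ℤ))⁻¹ := by
    intro x hx
    have h1 : e.symm (Multiplicative.ofAdd (1 : ℤ)) ∈ Subgroup.closure ({x} : Set G) := by
      rw [hx]; exact Subgroup.mem_top _
    obtain ⟨n, hn⟩ := Subgroup.mem_closure_singleton.1 h1
    have hn' : (e x) ^ n = Multiplicative.ofAdd (1 : ℤ) := by
      rw [← map_zpow, hn, MulEquiv.apply_symm_apply]
    set a : ℤ := Multiplicative.toAdd (e x) with ha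
    have hxa : e x = Multiplicative.ofAdd a := by rw [ha, ofAdd_toAdd]
    rw [hxa, ← ofAdd_zsmul, smul_eq_mul] at hn'
    have hna : n * a = 1 := Multiplicative.ofAdd.injective hn'
    rw [hxa, ← ofAdd_neg]
    rcases Int.eq_one_or_neg_one_of_mul_eq_one' hna with ⟨-, h⟩ | ⟨-, h⟩
    · exact Or.inl (by rw [h])
    · exact Or.inr (by rw [h])
  have hcd : e c = e d ∨ e c = (e d)⁻¹ := by
    rcases key c hc with h | h <;> rcases key d hd with h' | h' <;> simp [h, h']
  rcases hcd with h | h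
  · exact Or.inl (e.injective h)
  · exact Or.inr (e.injective (by rw [map_inv, h]))

/-- A surjective homomorphism maps a generator of a cyclic group to a generator. -/
private theorem closure_singleton_map_eq_top {G H : Type*} [Group G] [Group H] (f : G →* H)
    (hf : Surjective f) {t : G} (ht : Subgroup.closure ({t} : Set G) = ⊤) :
    Subgroup.closure ({f t} : Set H) = ⊤ := by
  rw [← image_singleton, ← MonoidHom.map_closure, ht, ← MonoidHom.range_eq_map,
    MonoidHom.range_eq_top]
  exact hf

section Circle

variable {X : Type} [TopologicalSpace X] [T2Space X]

/-- **`π₁` of the seam circle of a cell is infinite cyclic** at every base point: the loop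
`t ↦ Φ(cos 2πt, sin 2πt)` is a simple closed curve tracing out `Φ(‖z‖ = 1)` (Hatcher, Thm. 1.7,
via `exists_mulEquiv_int_apply_liftPath_of_simpleClosed`), and the base point is moved along a
path in the circle (Prop. 1.5). -/
private theorem nonempty_mulEquiv_int_cellCircle
    (Φ : C(closedBall (0 : EuclideanSpace ℝ (Fin 2)) 2, X)) (hinj : Injective Φ) {x₀ : X}
    (hx₀ : x₀ ∈ cellCircle Φ) :
    Nonempty (FundamentalGroup ↥(cellCircle Φ) ⟨x₀, hx₀⟩ ≃* Multiplicative ℤ) := by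
  set C := cellCircle Φ with hCdef
  set ι : C(closedBall (0 : EuclideanSpace ℝ (Fin 2)) 1,
      closedBall (0 : EuclideanSpace ℝ (Fin 2)) 2) :=
    ContinuousMap.inclusion (closedBall_subset_closedBall one_le_two) with hι
  have hιv : ∀ x, ((ι x : closedBall (0 : EuclideanSpace ℝ (Fin 2)) 2) :
      EuclideanSpace ℝ (Fin 2)) = x := fun x => rfl
  -- the standard loop around `C`
  set γ := (euclideanCircleLoop.map ι.continuous).map Φ.continuous with hγ
  have hγt : ∀ t, γ t = Φ (ι (euclideanCircleLoop t)) := fun t => rfl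
  have hγC : ∀ t, γ t ∈ C := fun t =>
    ⟨ι (euclideanCircleLoop t), by simpa [hιv] using norm_euclideanCircleLoop t, rfl⟩
  have hCγ : C ⊆ range γ := by
    rintro x ⟨z, hz1, rfl⟩
    have hz1' : ‖(z : EuclideanSpace ℝ (Fin 2))‖ = 1 := hz1
    set z' : closedBall (0 : EuclideanSpace ℝ (Fin 2)) 1 :=
      ⟨z, mem_closedBall_zero_iff.mpr hz1'.le⟩ with hz'
    obtain ⟨t, ht⟩ := mem_range_euclideanCircleLoop z' hz1'
    refine ⟨t, ?_⟩
    rw [hγt, ht]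
    exact congrArg Φ (Subtype.ext rfl)
  have hγinj : ∀ s t : unitInterval, γ s = γ t → s = t ∨ (s = 0 ∧ t = 1) ∨ (s = 1 ∧ t = 0) := by
    intro s t h
    rw [hγt, hγt] at h
    have h' : ι (euclideanCircleLoop s) = ι (euclideanCircleLoop t) := hinj h
    have h'' := congrArg (Subtype.val : closedBall (0 : EuclideanSpace ℝ (Fin 2)) 2 → _) h'
    exact euclideanCircleLoop_eq_iff s t (Subtype.ext h'')
  have hb : γ 0 ∈ C := hγC 0
  -- `π₁(C, γ 0) ≅ ℤ`
  obtain ⟨e₀, -⟩ := exists_mulEquiv_int_apply_liftPath_of_simpleClosed γ hγinj hγC hCγ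
    (by simpa using hb)
  -- move to `x₀` along a path in `C`
  haveI : PathConnectedSpace ↥C :=
    isPathConnected_iff_pathConnectedSpace.mp (isPathConnected_image_sphere Φ)
  let p : Path (⟨x₀, hx₀⟩ : ↥C) ⟨_, by simpa using hb⟩ := PathConnectedSpace.somePath _ _
  exact ⟨(FundamentalGroup.fundamentalGroupMulEquivOfPath p).trans e₀⟩

end Circle

/-! ## The stub -/

/-- **Nested cells transport cell bases inwards** (registered stub `stub_nestedCellsBasis`): for
chart-like cells `Φ`, `Ψ` in the closed `F` with `Φ(B̄(0,1)) ⊆ Ψ(B(0,1))`, if the region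
`R = Ψ(B̄(0,1)) ∖ Φ(B(0,1))` strong deformation retracts onto `Ψ(‖z‖ = 1)`, is path connected,
contains `Φ(‖z‖ = 1)` and every generator of `π₁(Φ(‖z‖ = 1), Φ(1,0))` generates `π₁(R, Φ(1,0))`,
then a cell basis of genus `g` for `Ψ` gives a cell basis of genus `g` for `Φ`: paste the
deformation with the identity of `F ∖ Ψ(B(0,1))` (Hatcher, Prop. 1.17), move the base point along
a path in `R` (Prop. 1.5), and compare the two generators in `π₁(R) ≅ ℤ` (Thm. 1.7). -/
theorem stub_nestedCellsBasis {X : Type} [TopologicalSpace X] [T2Space X] {F : Set X}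
    (hF : IsClosed F) (Φ Ψ : C(closedBall (0 : EuclideanSpace ℝ (Fin 2)) 2, X)) (OΦ OΨ : Set X)
    (hΦ : IsChartCell F Φ OΦ) (hΨ : IsChartCell F Ψ OΨ) (hnest : cellDisc Φ ⊆ cellHole Ψ)
    (hsdr : IsStrongDeformationRetractOf (cellCircle Ψ) (cellDisc Ψ \ cellHole Φ))
    (hRpc : IsPathConnected (cellDisc Ψ \ cellHole Φ))
    (hx : Φ cellPt ∈ cellCircle Φ) (hCR : cellCircle Φ ⊆ cellDisc Ψ \ cellHole Φ)
    (hgen : ∀ t : FundamentalGroup ↥(cellCircle Φ) ⟨Φ cellPt, hx⟩, Subgroup.closure {t} = ⊤ →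
        Subgroup.closure {inclHomOfSubset hCR _ hx (hCR hx) t} = ⊤)
    {g : ℕ} (hb : CellBasis F Ψ g) : CellBasis F Φ g := by
  obtain ⟨hΦinj, -, hOΦ, hFOΦ⟩ := hΦ
  obtain ⟨hΨinj, hΨF, hOΨ, hFOΨ⟩ := hΨ
  obtain ⟨hApc, hxΨ, hCAΨ, tΨ, θΨ, htΨ, hθΨ⟩ := hb
  /- set algebra: `A = F ∖ Ψ(B(0,1))`, `R = Ψ(B̄(0,1)) ∖ Φ(B(0,1))`, `B = F ∖ Φ(B(0,1))`,
  `C = Ψ(‖z‖ = 1)` -/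
  have hholeDisc : ∀ Θ : C(closedBall (0 : EuclideanSpace ℝ (Fin 2)) 2, X),
      cellHole Θ ⊆ cellDisc Θ := fun Θ =>
    image_mono fun z hz => show ‖(z : EuclideanSpace ℝ (Fin 2))‖ ≤ 1 from le_of_lt hz
  have hcircDisc : ∀ Θ : C(closedBall (0 : EuclideanSpace ℝ (Fin 2)) 2, X),
      cellCircle Θ ⊆ cellDisc Θ := fun Θ =>
    image_mono fun z hz => show ‖(z : EuclideanSpace ℝ (Fin 2))‖ ≤ 1 from le_of_eq hz
  have hdiscF : cellDisc Ψ ⊆ F := (image_subset_range _ _).trans hΨF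
  have hRB : cellDisc Ψ \ cellHole Φ ⊆ F \ cellHole Φ := Set.sdiff_subset_sdiff_left hdiscF
  have hAB : F \ cellHole Ψ ⊆ F \ cellHole Φ :=
    Set.sdiff_subset_sdiff_right ((hholeDisc Φ).trans hnest)
  have hARB : (F \ cellHole Ψ) ∪ (cellDisc Ψ \ cellHole Φ) = F \ cellHole Φ := by
    refine subset_antisymm (union_subset hAB hRB) fun x hx' => ?_
    by_cases hxh : x ∈ cellHole Ψ
    · exact Or.inr ⟨hholeDisc Ψ hxh, hx'.2⟩
    · exact Or.inl ⟨hx'.1, hxh⟩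
  have hARC : (F \ cellHole Ψ) ∩ (cellDisc Ψ \ cellHole Φ) ⊆ cellCircle Ψ := by
    rintro x ⟨⟨-, hxh⟩, ⟨z, hz, rfl⟩, -⟩
    refine ⟨z, ?_, rfl⟩
    rcases (show ‖(z : EuclideanSpace ℝ (Fin 2))‖ ≤ 1 from hz).lt_or_eq with h | h
    · exact absurd ⟨z, h, rfl⟩ hxh
    · exact h
  have hCRA : cellCircle Ψ ∩ (cellDisc Ψ \ cellHole Φ) ⊆ F \ cellHole Ψ := fun x hx' => hCAΨ hx'.1
  have hCRΨ : cellCircle Ψ ⊆ cellDisc Ψ \ cellHole Φ := fun x hx' =>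
    ⟨hcircDisc Ψ hx', fun h => (hCAΨ hx').2 (hnest (hholeDisc Φ h))⟩
  -- closedness of `A`, `B`, `R`
  have hAcl : IsClosed (F \ cellHole Ψ) := isClosed_diff_image_ball Ψ hF hΨinj hOΨ hFOΨ
  have hBcl : IsClosed (F \ cellHole Φ) := isClosed_diff_image_ball Φ hF hΦinj hOΦ hFOΦ
  have hRcl : IsClosed (cellDisc Ψ \ cellHole Φ) := by
    have e : cellDisc Ψ \ cellHole Φ = cellDisc Ψ ∩ (F \ cellHole Φ) := by
      ext x
      exact ⟨fun h => ⟨h.1, hdiscF h.1, h.2⟩, fun h => ⟨h.1, h.2.2⟩⟩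
    rw [e]
    haveI : CompactSpace (closedBall (0 : EuclideanSpace ℝ (Fin 2)) 2) :=
      isCompact_iff_compactSpace.mp (isCompact_closedBall 0 2)
    refine IsClosed.inter (IsCompact.isClosed ?_) hBcl
    exact ((isClosed_le (continuous_norm.comp continuous_subtype_val)
      continuous_const).isCompact).image Ψ.continuous
  /- Step 1: `A` is a strong deformation retract of `B = A ∪ R` -/
  have hsdrAB : IsStrongDeformationRetractOf (F \ cellHole Ψ) (F \ cellHole Φ) := by
    have h := hsdr.union_of_inter_subset hARC hCRA
      (fun x hx' => by rw [hAcl.closure_eq] at hx'; exact hx'.1)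
      (fun x hx' => by rw [hRcl.closure_eq] at hx'; exact hx'.1)
    rwa [hARB] at h
  /- Step 2: `π₁(A, Ψ(1,0)) → π₁(B, Ψ(1,0))` is bijective -/
  have hι := bijective_inclHomOfSubset_of_isStrongDeformationRetractOf hsdrAB hAB (hCAΨ hxΨ)
  /- Step 3: a path from `Ψ(1,0)` to `Φ(1,0)` in `R` and the base changes along it -/
  obtain ⟨γ, hγ⟩ := hRpc.joinedIn _ (hCRΨ hxΨ) _ (hCR hx)
  let βB := FundamentalGroup.fundamentalGroupMulEquivOfPath
    (liftPath (F \ cellHole Φ) γ fun t => hRB (hγ t))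
  let βR := FundamentalGroup.fundamentalGroupMulEquivOfPath (liftPath (cellDisc Ψ \ cellHole Φ) γ hγ)
  -- the new free basis
  let θ : FreeGroup (surfaceGen g) ≃* FundamentalGroup ↥(F \ cellHole Φ) ⟨Φ cellPt, hRB (hCR hx)⟩ :=
    (θΨ.trans (MulEquiv.ofBijective _ hι)).trans βB
  /- Step 4: the two generators of `π₁(R, Φ(1,0)) ≅ ℤ` -/
  have hιR := bijective_inclHomOfSubset_of_isStrongDeformationRetractOf hsdr hCRΨ hxΨ
  set c := βR (inclHomOfSubset hCRΨ (Ψ cellPt) hxΨ (hCRΨ hxΨ) tΨ) with hcdef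
  have hc : Subgroup.closure ({c} : Set _) = ⊤ := by
    rw [hcdef]
    exact closure_singleton_map_eq_top βR.toMonoidHom βR.surjective
      (closure_singleton_map_eq_top _ hιR.2 htΨ)
  obtain ⟨t₀, ht₀⟩ : ∃ t₀ : FundamentalGroup ↥(cellCircle Φ) ⟨Φ cellPt, hx⟩,
      Subgroup.closure {t₀} = ⊤ :=
    exists_closure_singleton_eq_top_image_sphere Φ hΦinj hx
  have hd := hgen t₀ ht₀
  obtain ⟨e⟩ : Nonempty (FundamentalGroup ↥(cellDisc Ψ \ cellHole Φ) ⟨Φ cellPt, hCR hx⟩ ≃*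
      Multiplicative ℤ) := by
    obtain ⟨e₀⟩ := nonempty_mulEquiv_int_cellCircle Ψ hΨinj hxΨ
    exact ⟨(βR.symm.trans (MulEquiv.ofBijective _ hιR).symm).trans e₀⟩
  have hcd := eq_or_eq_inv_of_closure_singleton_eq_top e hc hd
  -- `θ(r_g)` is the transported outer generator read in `B`
  have hθr : θ (surfaceRelator g) =
      inclHomOfSubset hRB (Φ cellPt) (hCR hx) (hRB (hCR hx)) c := by
    show βB (inclHomOfSubset hAB (Ψ cellPt) (hCAΨ hxΨ) (hAB (hCAΨ hxΨ)) (θΨ (surfaceRelator g))) = _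
    rw [hθΨ, inclHomOfSubset_inclHomOfSubset, hcdef,
      inclHomOfSubset_fundamentalGroupMulEquivOfPath hRB (hCRΨ hxΨ) (hCR hx) γ hγ,
      inclHomOfSubset_inclHomOfSubset]
  /- assembly -/
  refine ⟨?_, hx, hCR.trans hRB, ?_⟩
  · rw [← hARB]
    exact hApc.union hRpc ⟨Ψ cellPt, hCAΨ hxΨ, hCRΨ hxΨ⟩
  · rcases hcd with hcd | hcd
    · refine ⟨t₀, θ, ht₀, ?_⟩
      rw [hθr, hcd, inclHomOfSubset_inclHomOfSubset]
    · refine ⟨t₀⁻¹, θ, ?_, ?_⟩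
      · rwa [← Subgroup.zpowers_eq_closure, Subgroup.zpowers_inv, Subgroup.zpowers_eq_closure]
      · rw [hθr, hcd, ← map_inv (inclHomOfSubset hCR _ hx (hCR hx)) t₀,
          inclHomOfSubset_inclHomOfSubset]

end Summit.SmoothPoincare4.SmoothPoincare4.Cruxes.AgkCor6Sufficiency.LpBySphereSystemSurgery

end
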